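/-
Copyright (c) 2026 the pub-hodgecm-mathlib formalisation cell (harness21).  Prover seat hodgecm-mathlib-LH7-p09 (g2), CLOSE-OUT ROSTER strike line L3∕L5 (Track A
«(D-RAM) FOUR-FRAME» squad F0∕P3c∕LH4 ∕ F0∕P3c∕LH7); β₂-BOARD v2 row (OFF) (lead LH7-p09 (g2); assembler LH4-p12 (g8) ED. 5 `…OffRowOfPiecesResidual`, socket `hL`);
helper lane on h413 = stmt-HodgeConjecture-24833 (count-neutral).  2026-09-05.
-/
import Summits.HodgeConjecture.HodgeConjecture.Theorems.F0P3cDyRamLowerLineOnShell     -- ★ p863269 (this seat): the lower-line digit; brings ★ p862572 coordinates `mul_map_sub_mul_map_eq`, ★ DEFS `IsOrd`, `dualGen`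
import HarnessLib

/-!
# Crux `H413`, line LH4 «(D-RAM) FOUR-FRAME» — the (β₂) road (R-36), β₂-BOARD v2 row (OFF), socket `hL`: «THE RAY LETTERS OF THE LOWER LINE» — on the lower line
# `j + b + ℓ₀ = jl′` (`2b + ℓ₀ < m₀`, `b < j`) the ray scalar `e₀ = Tr_ρ(μ∕(cc(α − ρα)·ΘY))` has size EXACTLY `|ϖ|^{ℓ₀}` and the depth element is ray-dominated at the
# modulus `b + ℓ₀` (`μ∕ϖE^{b+ℓ₀} ∈ 𝒪_cc`) — the two input letters of ★ `…RayScalarNearlyFixed` (LH4-p16) for the band `b + ℓ₀ ≥ m*` of the lower line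

Cell `hodgecm-mathlib` (D-0151), FLOOR 0, crux item H413 = `stmt-HodgeConjecture-24833`, route of record `HCCMUnconditional`; squads F0∕P3c∕LH4 ∕ LH7; lane
`--supports stmt-HodgeConjecture-24833 --as helper` (count-neutral; pays NO tier-0 row).  THEOREMS ONLY (no `def`, no instance, no notation, no `sorry`, default heartbeats);
★-only imports; states NO law; (β₂) stays a HYPOTHESIS.  DATUM-FREE: line model `(M, jE, ρ, Θ, α)` (`ρ` an isometric involution, `Θ` isometric commuting with `ρ`,
`ρα ≠ α`, `|α| ≤ 1`, `|jE c| ≤ 1 ↔ |c| ≤ 1`, `|ϖ| = exp(−1)`), a cell datum `cc = ρcc ≠ 0`, `Y ∈ 𝒪_cc`, `|Y| = |ϖE|^b`, `|cc| < |ϖE|^b`.  NO residue field, NO `|2|`, NO `σ`.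

WHY (the LABEL half of the (OFF) socket `hL`, after ★ p863269 ∕ ★ FILE 8 removed its shell conjuncts).  By ★ `…DepthFormLineModel.valueSet_endoGL_sub_one_glued_eq_normFormSet_of_gen`
the census letter of a glued vertex over `Λ = x₀·𝒪_cc` is the norm-form set of `κ = μ∕(cc(α − ρα)·ΘY)`, `Y = dualGen …  x₀`, and by ★ p861653 `normFormSet_eq_ray_of_isOrd` it is the
thickened RAY of the scalar `e₀`, `jE e₀ = Tr_ρ κ`, as soon as `μ = ϖE^{m′}·μ_t` with `μ_t ∈ 𝒪_cc`, `m′ ≥ m*` (ray domination).  ★ `…RayScalarNearlyFixed.exists_fixed_unit_valueSet_endoGL_sub_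
one_glued_eq_smul_xPlus` (LH4-p16) then labels the vertex by `ω(e′)` for a `σ`-fixed unit `e′`, PROVIDED `|e₀| = |ϖ|^{d % 2}`.  On the LOWER LINE both provisos are size facts
in ★ p862572's `Fix ρ`-coordinates `μ = A + Bα`, `ΘY = P′ + Q′α`: `Tr_ρ κ = (B·P′ − A·Q′)∕(cc·ΘY·ρΘY)` with `|B·P′| = |cc|·|ϖE|^{2b+ℓ₀}` EXACTLY dominating `|A·Q′|`
(the digit of ★ p863269 §2, read at `ΘY ∈ 𝒪_cc` instead of `Y`), so `|Tr_ρ κ| = |ϖE|^{ℓ₀}`; and `|μ − ρμ| = |cc(α − ρα)|·|ϖE|^{b+ℓ₀}` says `μ∕ϖE^{b+ℓ₀} ∈ 𝒪_cc`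
(ray domination at `m′ = b + ℓ₀`, so at `m*` on the band `b + ℓ₀ ≥ m*`).
* §1 `add_map_div_eq_of_coords` (the trace in coordinates), `v_add_map_div_eq_of_line` (`|Tr_ρ(μ∕(cc(α − ρα)·Y′))| = |ϖE|^{ℓ₀}` for any `Y′ ∈ 𝒪_cc` with `|Y′| = |ϖE|^b`).
* §2 `isOrd_map_theta` (`Y ∈ 𝒪_cc ⇒ ΘY ∈ 𝒪_cc`), HEAD **`v_rayScalar_eq_of_line`** (`jE e₀ = Tr_ρ(μ∕(cc(α − ρα)·ΘY))` ⇒ `|e₀| = |ϖ|^{ℓ₀}`), HEAD **`isOrd_div_pow_of_line`**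
  (`μ∕ϖE^{b+ℓ₀} ∈ 𝒪_cc`) and `eq_map_pow_mul_div_pow` (`μ = jE(ϖ^{b+ℓ₀})·(μ∕ϖE^{b+ℓ₀})`, the shape ★ p16's HEAD consumes).
CONSEQUENCE (plan, not typed here): on the band `m* ≤ b + ℓ₀` of the lower line every glued vertex is a `σ`-fixed-unit ray at the modulus `m*` (LH4-p16's HEAD with `m′ := b + ℓ₀`),
so `hL` there is the balance of `ω(e′(Λ))` against the weight `f` over `levelSet(j, b)` (= `levelSetDep` by ★ `levelSetDep_eq_levelSet_of_add_le`) — LH4-p19 (g2)'s digit engine.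
HONEST LABEL.  Count-neutral valuation algebra; nothing printed is asserted; no census law is stated; the balance `hL` stays OPEN; `HC_CM` is proved only modulo the 7 printed
citations (2 remaining named inputs: hLiu418 = `stmt-HodgeConjecture-24832`, h413 = `stmt-HodgeConjecture-24833`) until rung 0 closes.
## References
* [Serre1979] J.-P. Serre, *Local Fields*, GTM 67 (1979): Ch. III §6 Prop. 12 (orders of conductor `c`).
* [Kottwitz1986BaseChangeUnits] R. E. Kottwitz, *Base change for unit elements of Hecke algebras*, Compositio Math. 60 (1986): §1 pp. 240–241.
* [Jacobowitz1962] R. Jacobowitz, *Hermitian forms over local fields*, Amer. J. Math. 84 (1962): §4 (duals, gluing).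
* [Rogawski1990] J. D. Rogawski, *Automorphic Representations of Unitary Groups in Three Variables*, Ann. of Math. Stud. 123 (1990): §4.9 Prop. 4.9.1 (b) p. 55.
-/

set_option autoImplicit false

noncomputable section
namespace Summit.HodgeConjecture.HodgeConjecture.Cruxes.H413.F0P3cDyRamLowerLineRayLetters

open scoped Valued WithZero
open WithZero
open Literature.NumberTheory.Rogawski1990
open Summit.HodgeConjecture.HodgeConjecture.Cruxes.H413.F0P3cDyRamToricCensusDefs
open Summit.HodgeConjecture.HodgeConjecture.Cruxes.H413.F0P3cDyRamBoundaryCellLetterCardTwo (v_map_lt_one_iff_of_le_iff v_map_eq_map_pow_iff)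
open Summit.HodgeConjecture.HodgeConjecture.Cruxes.H413.F0P3cDyRamTerminalCellOffShellCardTwo (mul_map_sub_mul_map_eq)

variable {E M : Type} [Field E] [Valued E ℤᵐ⁰] [Field M] [Valued M ℤᵐ⁰] {ρ Θ : M →+* M} {α : M}
/-! ## §1 The trace of `μ∕(cc(α − ρα)·Y′)` in the `Fix ρ`-coordinates, and its size on the lower line -/

omit [Valued M ℤᵐ⁰] in
/-- **THE RAY SCALAR IN COORDINATES.**  `ρ` an involution, `ρα ≠ α`, `ρcc = cc`, `cc ≠ 0`, `Y′ ≠ 0`, `ρY′ ≠ 0`; `μ = A + B·α`, `Y′ = P + Q·α` (★ p862572 coordinates).  THEN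
`μ∕(cc(α − ρα)Y′) + ρ(μ∕(cc(α − ρα)Y′)) = (B·P − A·Q)∕(cc·(Y′·ρY′))` (`ρ` flips the sign of `α − ρα`). [cite: Serre1979, Ch. III §6 Prop. 12] -/
theorem add_map_div_eq_of_coords (hρρ : ∀ x, ρ (ρ x) = x) (hα : ρ α ≠ α) {cc : M} (hc : ρ cc = cc) (hc0 : cc ≠ 0)
    {μ Y' A B P Q : M} (hY0 : Y' ≠ 0) (hρY0 : ρ Y' ≠ 0)
    (hB : B = (μ - ρ μ) / (α - ρ α)) (hA : A = μ - B * α) (hQ : Q = (Y' - ρ Y') / (α - ρ α)) (hP : P = Y' - Q * α) :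
    μ / (cc * (α - ρ α) * Y') + ρ (μ / (cc * (α - ρ α) * Y')) = (B * P - A * Q) / (cc * (Y' * ρ Y')) := by
  have hα0 : α - ρ α ≠ 0 := sub_ne_zero.2 (Ne.symm hα)
  have hρden : ρ (cc * (α - ρ α) * Y') = -(cc * (α - ρ α)) * ρ Y' := by rw [map_mul, map_mul, map_sub, hρρ, hc]; ring
  have e : μ / (cc * (α - ρ α) * Y') + ρ (μ / (cc * (α - ρ α) * Y')) = (μ * ρ Y' - Y' * ρ μ) / (cc * (α - ρ α) * (Y' * ρ Y')) := by
    rw [map_div₀, hρden]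
    field_simp
    ring
  rw [e, mul_map_sub_mul_map_eq hα hB hA hQ hP]
  field_simp

/-- **THE RAY SCALAR OF THE LOWER LINE HAS SIZE EXACTLY `|ϖE|^{ℓ₀}`.**  `ρ` an isometric involution, `ρα ≠ α`, `|α| ≤ 1`, `|ϖ| = exp(−1)`, `|jE c| ≤ 1 ↔ |c| ≤ 1`; `ρcc = cc ≠ 0`;
`Y′ ∈ 𝒪_cc`, `|Y′| = |ϖE|^b`, `|cc| < |ϖE|^b` (`b < j`); LOWER-LINE letters `|μ| ≤ |ϖE|^{2b+ℓ₀+1}`, `|μ − ρμ| = |cc(α − ρα)|·|ϖE|^{b+ℓ₀}`.  THEN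
`|μ∕(cc(α − ρα)Y′) + ρ(μ∕(cc(α − ρα)Y′))| = |ϖE|^{ℓ₀}`: `|B·P| = |cc|·|ϖE|^{2b+ℓ₀}` EXACTLY dominates `|A·Q|` (the digit of ★ p863269 §2).
[cite: Serre1979, Ch. III §6 Prop. 12] [cite: Kottwitz1986BaseChangeUnits, §1 pp. 240–241] -/
theorem v_add_map_div_eq_of_line
    (hρρ : ∀ x, ρ (ρ x) = x) (hvρ : ∀ x, Valued.v (ρ x) = Valued.v x) (hα : ρ α ≠ α) (hα1 : Valued.v α ≤ 1)
    (jE : E →+* M) (hjv : ∀ c, Valued.v (jE c) ≤ 1 ↔ Valued.v c ≤ 1) {ϖ : E} (hϖ : Valued.v ϖ = exp (-1 : ℤ))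
    {cc : M} (hc : ρ cc = cc) (hc0 : cc ≠ 0) {Y' : M} (hYO : IsOrd ρ α cc Y') {b : ℕ} (hYb : Valued.v Y' = Valued.v (jE ϖ) ^ b) (hcb : Valued.v cc < Valued.v (jE ϖ) ^ b)
    (ℓ₀ : ℕ) {μ : M} (hμ : Valued.v μ ≤ Valued.v (jE ϖ) ^ (2 * b + ℓ₀ + 1))
    (hanti : Valued.v (μ - ρ μ) = Valued.v (cc * (α - ρ α)) * Valued.v (jE ϖ) ^ (b + ℓ₀)) :
    Valued.v (μ / (cc * (α - ρ α) * Y') + ρ (μ / (cc * (α - ρ α) * Y'))) = Valued.v (jE ϖ) ^ ℓ₀ := by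
  have hα0 : α - ρ α ≠ 0 := sub_ne_zero.2 (Ne.symm hα)
  have hvα0 : Valued.v (α - ρ α) ≠ 0 := (Valuation.ne_zero_iff _).2 hα0
  have hvαpos : 0 < Valued.v (α - ρ α) := zero_lt_iff.2 hvα0
  have hvϖ0 : Valued.v ϖ ≠ 0 := by rw [hϖ]; exact exp_ne_zero
  have hϖ0 : ϖ ≠ 0 := fun h0 => hvϖ0 (by rw [h0, map_zero])
  have hϖlt : Valued.v ϖ < 1 := by rw [hϖ, ← exp_zero, exp_lt_exp]; norm_num
  have hjϖ0 : jE ϖ ≠ 0 := (map_ne_zero jE).2 hϖ0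
  have hvjϖ0 : Valued.v (jE ϖ) ≠ 0 := (Valuation.ne_zero_iff _).2 hjϖ0
  have hvjϖpos : 0 < Valued.v (jE ϖ) := zero_lt_iff.2 hvjϖ0
  have hjϖlt : Valued.v (jE ϖ) < 1 := (v_map_lt_one_iff_of_le_iff jE hjv ϖ).2 hϖlt
  have hpbpos : 0 < Valued.v (jE ϖ) ^ b := pow_pos hvjϖpos _
  have hvc0 : Valued.v cc ≠ 0 := (Valuation.ne_zero_iff _).2 hc0
  have hvcpos : 0 < Valued.v cc := zero_lt_iff.2 hvc0
  have hY0 : Y' ≠ 0 := fun h0 => by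
    rw [h0, Valuation.map_zero] at hYb
    exact pow_ne_zero b hvjϖ0 hYb.symm
  have hρY0 : ρ Y' ≠ 0 := (map_ne_zero ρ).2 hY0
  -- coordinates
  set B : M := (μ - ρ μ) / (α - ρ α) with hBdef
  set Q : M := (Y' - ρ Y') / (α - ρ α) with hQdef
  set A : M := μ - B * α with hAdef
  set P : M := Y' - Q * α with hPdef
  rw [add_map_div_eq_of_coords hρρ hα hc hc0 hY0 hρY0 hBdef hAdef hQdef hPdef]
  clear_value A P
  clear_value B Q
  have hvB : Valued.v B = Valued.v cc * Valued.v (jE ϖ) ^ (b + ℓ₀) := by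
    have h : Valued.v B * Valued.v (α - ρ α) = Valued.v cc * Valued.v (jE ϖ) ^ (b + ℓ₀) * Valued.v (α - ρ α) := by
      rw [hBdef, Valuation.map_div, div_mul_cancel₀ _ hvα0, hanti, Valuation.map_mul]; ac_rfl
    exact mul_right_cancel₀ hvα0 h
  have hvQ : Valued.v Q ≤ Valued.v cc := by
    rw [hQdef, Valuation.map_div, div_le_iff₀ hvαpos, ← Valuation.map_mul]
    exact hYO.2
  have hvP : Valued.v P = Valued.v (jE ϖ) ^ b := by
    have hlt : Valued.v (Q * α) < Valued.v Y' := by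
      rw [Valuation.map_mul, hYb]
      calc Valued.v Q * Valued.v α ≤ Valued.v cc * 1 := mul_le_mul' hvQ hα1
        _ = Valued.v cc := mul_one _
        _ < Valued.v (jE ϖ) ^ b := hcb
    rw [hPdef, sub_eq_add_neg, Valuation.map_add_eq_of_lt_left _ (by rw [Valuation.map_neg]; exact hlt), hYb]
  have hBP : Valued.v (B * P) = Valued.v cc * Valued.v (jE ϖ) ^ (2 * b + ℓ₀) := by
    rw [Valuation.map_mul, hvB, hvP, mul_assoc, ← pow_add]; congr 2; omega
  have hvA : Valued.v A < Valued.v (jE ϖ) ^ (2 * b + ℓ₀) := by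
    rw [hAdef]
    refine lt_of_le_of_lt (Valuation.map_sub _ _ _) (max_lt ?_ ?_)
    · exact lt_of_le_of_lt hμ (pow_lt_pow_right_of_lt_one₀ hvjϖpos hjϖlt (by omega))
    · rw [Valuation.map_mul, hvB]
      calc Valued.v cc * Valued.v (jE ϖ) ^ (b + ℓ₀) * Valued.v α ≤ Valued.v cc * Valued.v (jE ϖ) ^ (b + ℓ₀) * 1 := mul_le_mul_right hα1 _
        _ = Valued.v cc * Valued.v (jE ϖ) ^ (b + ℓ₀) := mul_one _
        _ < Valued.v (jE ϖ) ^ b * Valued.v (jE ϖ) ^ (b + ℓ₀) := mul_lt_mul_of_pos_right hcb (pow_pos hvjϖpos _)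
        _ = Valued.v (jE ϖ) ^ (2 * b + ℓ₀) := by rw [← pow_add]; congr 1; omega
  have hdom : Valued.v (A * Q) < Valued.v (B * P) := by
    rw [hBP, Valuation.map_mul]
    calc Valued.v A * Valued.v Q ≤ Valued.v A * Valued.v cc := mul_le_mul_right hvQ _
      _ < Valued.v (jE ϖ) ^ (2 * b + ℓ₀) * Valued.v cc := mul_lt_mul_of_pos_right hvA hvcpos
      _ = Valued.v cc * Valued.v (jE ϖ) ^ (2 * b + ℓ₀) := mul_comm _ _
  have hdiff : Valued.v (B * P - A * Q) = Valued.v cc * Valued.v (jE ϖ) ^ (2 * b + ℓ₀) := by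
    rw [sub_eq_add_neg, Valuation.map_add_eq_of_lt_left _ (by rw [Valuation.map_neg]; exact hdom), hBP]
  rw [Valuation.map_div, hdiff, Valuation.map_mul, Valuation.map_mul, hvρ, hYb,
    div_eq_iff (mul_ne_zero hvc0 (mul_ne_zero (pow_ne_zero _ hvjϖ0) (pow_ne_zero _ hvjϖ0))), pow_add, two_mul, pow_add]
  ac_rfl
/-! ## §2 HEADS — the two input letters of the ray dictionary on the lower line -/

omit [Valued E ℤᵐ⁰] [Field E] in
/-- `Θ` (isometric, commuting with `ρ`) preserves every order: `Y ∈ 𝒪_cc ⇒ ΘY ∈ 𝒪_{Θcc}`; with `|Θcc| = |cc|` this is `ΘY ∈ 𝒪_cc` in sizes — stated as the two `IsOrd` clauses for `cc`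
when `|Θ(α − ρα)| = |α − ρα|`. [cite: Serre1979, Ch. III §6 Prop. 12] -/
theorem isOrd_map_theta (hΘρ : ∀ x, Θ (ρ x) = ρ (Θ x)) (hvΘ : ∀ x, Valued.v (Θ x) = Valued.v x) {cc Y : M} (hYO : IsOrd ρ α cc Y) :
    IsOrd ρ α cc (Θ Y) := by
  refine ⟨by rw [hvΘ]; exact hYO.1, ?_⟩
  rw [← hΘρ, ← map_sub, hvΘ]
  exact hYO.2

/-- **HEAD — «THE RAY SCALAR OF A LOWER-LINE VERTEX IS ON THE `ℓ₀`-SHELL»: `|e₀| = |ϖ|^{ℓ₀}`.**  Line model (`ρ` an isometric involution, `Θ` isometric commuting with `ρ`, `ρα ≠ α`,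
`|α| ≤ 1`, `|jE c| ≤ 1 ↔ |c| ≤ 1`, `|ϖ| = exp(−1)`); CELL `ρcc = cc ≠ 0`, `Y ∈ 𝒪_cc`, `|Y| = |ϖE|^b`, `|cc| < |ϖE|^b`; LOWER-LINE letters `|μ| ≤ |ϖE|^{2b+ℓ₀+1}`,
`|μ − ρμ| = |cc(α − ρα)|·|ϖE|^{b+ℓ₀}`; the ray scalar `e₀ ∈ E` with `jE e₀ = μ∕(cc(α − ρα)·ΘY) + ρ(μ∕(cc(α − ρα)·ΘY))` (★ `…RayScalarNearlyFixed`'s `he₀`).  THEN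
`|e₀| = |ϖ|^{ℓ₀}` — at `ℓ₀ = d % 2` the letter `he₀v` of LH4-p16's HEAD. [cite: Serre1979, Ch. III §6 Prop. 12] [cite: Rogawski1990, §4.9 Prop. 4.9.1 (b) p. 55] -/
theorem v_rayScalar_eq_of_line
    (hρρ : ∀ x, ρ (ρ x) = x) (hvρ : ∀ x, Valued.v (ρ x) = Valued.v x) (hα : ρ α ≠ α) (hα1 : Valued.v α ≤ 1)
    (hΘρ : ∀ x, Θ (ρ x) = ρ (Θ x)) (hvΘ : ∀ x, Valued.v (Θ x) = Valued.v x)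
    (jE : E →+* M) (hjv : ∀ c, Valued.v (jE c) ≤ 1 ↔ Valued.v c ≤ 1) {ϖ : E} (hϖ : Valued.v ϖ = exp (-1 : ℤ))
    {cc : M} (hc : ρ cc = cc) (hc0 : cc ≠ 0) {Y : M} (hYO : IsOrd ρ α cc Y) {b : ℕ} (hYb : Valued.v Y = Valued.v (jE ϖ) ^ b) (hcb : Valued.v cc < Valued.v (jE ϖ) ^ b)
    (ℓ₀ : ℕ) {μ : M} (hμ : Valued.v μ ≤ Valued.v (jE ϖ) ^ (2 * b + ℓ₀ + 1))
    (hanti : Valued.v (μ - ρ μ) = Valued.v (cc * (α - ρ α)) * Valued.v (jE ϖ) ^ (b + ℓ₀))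
    {e₀ : E} (he₀ : jE e₀ = μ / (cc * (α - ρ α) * Θ Y) + ρ (μ / (cc * (α - ρ α) * Θ Y))) :
    Valued.v e₀ = Valued.v ϖ ^ ℓ₀ := by
  have hvϖ0 : Valued.v ϖ ≠ 0 := by rw [hϖ]; exact exp_ne_zero
  have hϖ0 : ϖ ≠ 0 := fun h0 => hvϖ0 (by rw [h0, map_zero])
  have hYb' : Valued.v (Θ Y) = Valued.v (jE ϖ) ^ b := by rw [hvΘ, hYb]
  have h := v_add_map_div_eq_of_line hρρ hvρ hα hα1 jE hjv hϖ hc hc0 (isOrd_map_theta hΘρ hvΘ hYO) hYb' hcb ℓ₀ hμ hanti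
  rw [← he₀] at h
  exact (v_map_eq_map_pow_iff jE hjv hϖ0 e₀ ℓ₀).1 h

/-- **HEAD — «THE DEPTH ELEMENT OF THE LOWER LINE IS RAY-DOMINATED AT THE MODULUS `b + ℓ₀`»: `μ∕ϖE^{b+ℓ₀} ∈ 𝒪_cc`.**  `ρ(ϖE) = ϖE ≠ 0`, `|ϖE| ≤ 1`; LOWER-LINE letters
`|μ| ≤ |ϖE|^{2b+ℓ₀+1}` and `|μ − ρμ| ≤ |cc(α − ρα)|·|ϖE|^{b+ℓ₀}`.  THEN `IsOrd ρ α cc (μ ∕ ϖE^{b+ℓ₀})` — ★ p861653's ray-domination letter `hμt` with `m′ := b + ℓ₀`, which serves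
★ `…RayScalarNearlyFixed`'s HEAD at `m*` on the band `m* ≤ b + ℓ₀`. [cite: Serre1979, Ch. III §6 Prop. 12] [cite: Kottwitz1986BaseChangeUnits, §1 pp. 240–241] -/
theorem isOrd_div_pow_of_line {pE : M} (hρp : ρ pE = pE) (hp0 : pE ≠ 0) (hp1 : Valued.v pE ≤ 1)
    {cc : M} {b : ℕ} (ℓ₀ : ℕ) {μ : M} (hμ : Valued.v μ ≤ Valued.v pE ^ (2 * b + ℓ₀ + 1))
    (hanti : Valued.v (μ - ρ μ) ≤ Valued.v (cc * (α - ρ α)) * Valued.v pE ^ (b + ℓ₀)) :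
    IsOrd ρ α cc (μ / pE ^ (b + ℓ₀)) := by
  have hpk0 : pE ^ (b + ℓ₀) ≠ 0 := pow_ne_zero _ hp0
  have hvpkpos : 0 < Valued.v (pE ^ (b + ℓ₀)) := zero_lt_iff.2 ((Valuation.ne_zero_iff _).2 hpk0)
  refine ⟨?_, ?_⟩
  · rw [Valuation.map_div, div_le_one₀ hvpkpos, Valuation.map_pow]
    exact hμ.trans (pow_le_pow_right_of_le_one' hp1 (by omega))
  · have e : μ / pE ^ (b + ℓ₀) - ρ (μ / pE ^ (b + ℓ₀)) = (μ - ρ μ) / pE ^ (b + ℓ₀) := by rw [map_div₀, map_pow, hρp]; field_simp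
    rw [e, Valuation.map_div, div_le_iff₀ hvpkpos, Valuation.map_pow]
    exact hanti

omit [Valued E ℤᵐ⁰] [Valued M ℤᵐ⁰] in
/-- The ray-domination SHAPE ★ p16's HEAD consumes: `μ = jE(ϖ^{b+ℓ₀})·(μ∕jE ϖ^{b+ℓ₀})` (`jE ϖ ≠ 0`). [cite: Serre1979, Ch. III §6 Prop. 12] -/
theorem eq_map_pow_mul_div_pow (jE : E →+* M) {ϖ : E} (hjϖ0 : jE ϖ ≠ 0) (μ : M) (n : ℕ) :
    μ = jE (ϖ ^ n) * (μ / jE ϖ ^ n) := by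
  rw [map_pow, mul_div_cancel₀ _ (pow_ne_zero n hjϖ0)]

end Summit.HodgeConjecture.HodgeConjecture.Cruxes.H413.F0P3cDyRamLowerLineRayLetters

end
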